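import Summits.CriticalPhenomena.CardyFormulaZ2.Theorems.CardyIKTransportIKLinearTransportOfFarInputs

/-!
# `CardyIKTransport.IKLinearTransport` (stmt-CriticalPhenomena-5076) — THE TYPED SPLIT GLUE
# `IKLinearTransport ⇐ IKFarRSW ∧ IKWindowTransport`

Crux-strategist decomposition of the crux (seat `planner-cstrat-stmt-CriticalPhenomena-5076-s1-0`, `STRATEGY-CENSUS.md` and
`Lines/far_window_split.lean|.md` in `Cruxes/IKLinearTransport/`), landed by the line lead c6 (`--supports stmt-CriticalPhenomena-5076`;
planners cannot write under `Theorems/`). It is the live line `pinned-diagram-exchange` (skeleton v22) RE-CUT AT ROUTE-ITEM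
GRANULARITY: the two proposed route children are written INLINE over Literature vocabulary —

* `IKFarRSW` — the unconditional far RSW family of the column-mixed IK gauge at all aspect ratios with black rings, uniformly in
  the pattern (= `stub_MixedRSW` + `stub_FarRSWInputs` of the line, i.e. route crux r4 `IKMixedBoxCrossing` + FKG-free gluing);
* `IKWindowTransport` — `IKFarRSW` ⟹ Manolescu's window coupling (= `stub_WindowTransportCore` of the line with its seven PROVED
  hypotheses discharged: kernels, chain, per-step chain, box resampler, white family, ratio mixing, arm decay) —

and this file proves, sorry-free over the landed line: `farFamily_of_IKFarRSW` / `IKFarRSW_of_farFamily` (the inline `IKFarRSW` is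
EQUIVALENT to the line's `∀ k ∃ c … FarRSWBound c S n a b w h univ` family), `IKLinearTransport_of_farFamily_window` (far family +
`IKWindowTransport` ⟹ the crux BY NAME, through `stub_FarRSWOfInputs`, `linearTransport_of_parts_far`, `IKLinearTransport_of_stubs`,
…) and the split glue `IKLinearTransport_of_subs : IKFarRSW → IKWindowTransport → IKLinearTransport` against which the glue item of
`ledger route edit --split IKLinearTransport --into IKFarRSW IKWindowTransport` closes by `exact`. The first and third are registered
sub-goals of stmt-5076. No statement of the route or of the line is changed.
-/
noncomputable section

namespace Summit.CriticalPhenomena.CardyFormulaZ2.Theorems.IKLinearTransport.FarWindowSplit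

open Summit.CriticalPhenomena.CardyFormulaZ2.Theorems.IKLinearTransport.PinnedDiagramExchange

open scoped BigOperators Topology Classical MeasureTheory ProbabilityTheory ENNReal
open Filter Set Function MeasureTheory
open Literature.Probability.Percolation Literature.Probability.LatticeModels
open Literature.Probability.RandomPlanarGeometry

/-- The inline black set (set-builder spelling, structural decidability instance inside `Finset.filter`) is the line's
`blackSet S ω` (classical instance): the two filters agree by `Subsingleton` of `Decidable`. [folklore] -/
theorem split_blackSet_eq (S : Set ℤ) (ω : Ω) :
    {v : Site 2 | Xor (v 0 ∈ ω.1) (Xor (v 1 ∈ ω.2.1) (Odd ((Finset.filter (fun f : ℤ × ℤ => ![f.1, f.2] ∈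
      {f : Site 2 | (f 0 ∈ S ∧ f ∈ ω.2.2.1) ∨ (f 0 ∉ S ∧ f ∈ ω.2.2.2.1)})
      (Finset.Ico (min 0 (v 0)) (max 0 (v 0)) ×ˢ Finset.Ico (min 0 (v 1)) (max 0 (v 1)))).card)))} = blackSet S ω := by
  ext v
  simp only [blackSet, parSet, Set.mem_setOf_eq]

/-- The inline law of observables is the line's `νmix`. [folklore] -/
theorem split_nu_eq (S : Set ℤ) : (fun S : Set ℤ => ((sitePercolation ℤ half).prod ((sitePercolation ℤ half).prod ((sitePercolation (Site 2) (Set.projIcc (0:ℝ) 1 zero_le_one (2 * Real.sqrt 3 - 3))).prod ((sitePercolation (Site 2) half).prod (sitePercolation (Site 2) half))))).map (fun ω => ({v : Site 2 | Xor (v 0 ∈ ω.1) (Xor (v 1 ∈ ω.2.1) (Odd ((Finset.filter (fun f : ℤ × ℤ => ![f.1, f.2] ∈ {f : Site 2 | (f 0 ∈ S ∧ f ∈ ω.2.2.1) ∨ (f 0 ∉ S ∧ f ∈ ω.2.2.2.1)}) (Finset.Ico (min 0 (v 0)) (max 0 (v 0)) ×ˢ Finset.Ico (min 0 (v 1)) (max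 0 (v 1)))).card)))}, {f : Site 2 | f 0 ∉ S ∨ f ∈ ω.2.2.2.2}))) S = νmix S := by
  show Measure.map _ _ = Measure.map _ _
  congr 1
  funext ω
  exact Prod.ext (split_blackSet_eq S ω) rfl

/-- The inline ring event (`v ∉ x.1`) is the line's ring event (`monoPaths x false`, `farFrom`). [folklore] -/
theorem split_ringSet_eq (a b : ℤ) (w h n : ℕ) :
    {x : Obs | ∀ p : List (Site 2), (p ≠ [] ∧ List.IsChain (cellGraph x.2).Adj p ∧ ∀ v ∈ p, v ∉ x.1) →
        (∃ u ∈ p, a ≤ u 0 ∧ u 0 < a + w ∧ b ≤ u 1 ∧ u 1 < b + h) →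
        ∀ v ∈ p, ¬ (v 0 < a - n ∨ a + w + n ≤ v 0 ∨ v 1 < b - n ∨ b + h + n ≤ v 1)} =
    {x : Obs | ∀ p ∈ monoPaths x false,
        (∃ u ∈ p, a ≤ u 0 ∧ u 0 < a + w ∧ b ≤ u 1 ∧ u 1 < b + h) → ∀ v ∈ p, v ∉ farFrom a b w h n} := by
  ext x
  simp only [Set.mem_setOf_eq, monoPaths, farFrom, Bool.false_eq_true, iff_false]

/-- **SUB-CRUX 1 ⟹ THE LINE'S FAR FAMILY** (registered sub-goal `farFamily_of_IKFarRSW`): the inline statement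
`IKFarRSW` — for every aspect bound `k` a constant `c_k > 0` such that for every column pattern `S`, every `n ≥ 1` and
every `w × h` box with `n ≤ w, h ≤ k n`, the black left–right crossing, the black bottom–top crossing and the black ring
event "no white path from the box reaches sup-distance `n`" each have `ν_S`-probability `≥ c_k` — gives
`FarRSWBound c_k S n a b w h univ`. [folklore] -/
theorem farFamily_of_IKFarRSW :
    (let μ := (sitePercolation ℤ half).prod ((sitePercolation ℤ half).prod ((sitePercolation (Site 2) (Set.projIcc (0:ℝ) 1 zero_le_one (2 * Real.sqrt 3 - 3))).prod ((sitePercolation (Site 2) half).prod (sitePercolation (Site 2) half)))); let ν : Set ℤ → Measure (Set (Site 2) × Set (Site 2)) := fun S => μ.map (fun ω => ({v : Site 2 | Xor (v 0 ∈ ω.1) (Xor (v 1 ∈ ω.2.1) (Odd ((Finset.filter (fun f : ℤ × ℤ => ![f.1, f.2] ∈ {f : Site 2 | (f 0 ∈ S ∧ f ∈ ω.2.2.1) ∨ (f 0 ∉ S ∧ f ∈ ω.2.2.2.1)}) (Finset.Ico (min 0 (v 0)) (max 0 (v 0)) ×ˢ Finset.Ico (min 0 (v 1)) (max 0 (v 1)))).card)))},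 {f : Site 2 | f 0 ∉ S ∨ f ∈ ω.2.2.2.2})); let edges : (Set (Site 2) × Set (Site 2)) → BondConfig (Site 2) := fun x => {e | ∃ u v, e = s(u, v) ∧ u ∈ x.1 ∧ v ∈ x.1 ∧ (v = u + ![1, 0] ∨ v = u + ![0, 1] ∨ (v = u + ![1, 1] ∧ ¬ u ∈ x.2) ∨ (v = u + ![1, -1] ∧ (u + ![0, -1]) ∈ x.2))}; let adj : Set (Site 2) → SimpleGraph (Site 2) := fun A => SimpleGraph.fromRel fun u v => v = u + ![1, 0] ∨ v = u + ![0, 1] ∨ (v = u + ![1, 1] ∧ u ∉ A) ∨ (v = u + ![1, -1] ∧ (u + ![0, -1]) ∈ A); ∀ k : ℕ, ∃ c : ℝ, 0 < c ∧ ∀ (S : Set ℤ) (n : ℕ), 1 ≤ n → ∀ (a b : ℤ) (w h : ℕ), n ≤ w → w ≤ k * n → n ≤ h → h ≤ k * n → c ≤ (ν S).real {x | edges x ∈ openCrossing {v : Site 2 | a ≤ v 0 ∧ v 0 < a + w ∧ b ≤ v 1 ∧ v 1 < b + h} {v : Site 2 | v 0 = a ∧ b ≤ v 1 ∧ v 1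 < b + h} {v : Site 2 | v 0 = a + w - 1 ∧ b ≤ v 1 ∧ v 1 < b + h}} ∧ c ≤ (ν S).real {x | edges x ∈ openCrossing {v : Site 2 | a ≤ v 0 ∧ v 0 < a + w ∧ b ≤ v 1 ∧ v 1 < b + h} {v : Site 2 | v 1 = b ∧ a ≤ v 0 ∧ v 0 < a + w} {v : Site 2 | v 1 = b + h - 1 ∧ a ≤ v 0 ∧ v 0 < a + w}} ∧ c ≤ (ν S).real {x | ∀ p : List (Site 2), (p ≠ [] ∧ List.IsChain (adj x.2).Adj p ∧ ∀ v ∈ p, v ∉ x.1) → (∃ u ∈ p, a ≤ u 0 ∧ u 0 < a + w ∧ b ≤ u 1 ∧ u 1 < b + h) → ∀ v ∈ p, ¬ (v 0 < a - n ∨ a + w + n ≤ v 0 ∨ v 1 < b - n ∨ b + h + n ≤ v 1)}) → ∀ k : ℕ, ∃ c : ℝ, 0 < c ∧ ∀ (S : Set ℤ) (n : ℕ), 1 ≤ n → ∀ (a b : ℤ) (w h : ℕ), n ≤ w → w ≤ k * n → n ≤ h → h ≤ k * n → FarRSWBound c S n a b w h Set.univ := by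
  intro h₁ k
  obtain ⟨c, hc, hk⟩ := h₁ k
  refine ⟨c, hc, fun S n hn a b w hh h1 h2 h3 h4 _ => ?_⟩
  haveI : IsProbabilityMeasure (νmix S) := isProbabilityMeasure_nuMix S
  obtain ⟨hlr, htb, hring⟩ := hk S n hn a b w hh h1 h2 h3 h4
  have hlr' : c ≤ ((fun S : Set ℤ => ((sitePercolation ℤ half).prod ((sitePercolation ℤ half).prod ((sitePercolation (Site 2) (Set.projIcc (0:ℝ) 1 zero_le_one (2 * Real.sqrt 3 - 3))).prod ((sitePercolation (Site 2) half).prod (sitePercolation (Site 2) half))))).map (fun ω => ({v : Site 2 | Xor (v 0 ∈ ω.1) (Xor (v 1 ∈ ω.2.1) (Odd ((Finset.filter (fun f : ℤ × ℤ => ![f.1, f.2] ∈ {f : Site 2 | (f 0 ∈ S ∧ f ∈ ω.2.2.1) ∨ (f 0 ∉ S ∧ f ∈ ω.2.2.2.1)}) (Finset.Ico (min 0 (v 0)) (max 0 (v 0)) ×ˢ Finset.Ico (min 0 (v 1)) (max 0 (v 1)))).card)))}, {f : Site 2 | f 0 ∉ S ∨ f ∈ ω.2.2.2.2}))) S).real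 (lrCross a b w hh) := hlr
  have htb' : c ≤ ((fun S : Set ℤ => ((sitePercolation ℤ half).prod ((sitePercolation ℤ half).prod ((sitePercolation (Site 2) (Set.projIcc (0:ℝ) 1 zero_le_one (2 * Real.sqrt 3 - 3))).prod ((sitePercolation (Site 2) half).prod (sitePercolation (Site 2) half))))).map (fun ω => ({v : Site 2 | Xor (v 0 ∈ ω.1) (Xor (v 1 ∈ ω.2.1) (Odd ((Finset.filter (fun f : ℤ × ℤ => ![f.1, f.2] ∈ {f : Site 2 | (f 0 ∈ S ∧ f ∈ ω.2.2.1) ∨ (f 0 ∉ S ∧ f ∈ ω.2.2.2.1)}) (Finset.Ico (min 0 (v 0)) (max 0 (v 0)) ×ˢ Finset.Ico (min 0 (v 1)) (max 0 (v 1)))).card)))}, {f : Site 2 | f 0 ∉ S ∨ f ∈ ω.2.2.2.2}))) S).real (tbCross a b w hh) := htb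
  have hring' : c ≤ ((fun S : Set ℤ => ((sitePercolation ℤ half).prod ((sitePercolation ℤ half).prod ((sitePercolation (Site 2) (Set.projIcc (0:ℝ) 1 zero_le_one (2 * Real.sqrt 3 - 3))).prod ((sitePercolation (Site 2) half).prod (sitePercolation (Site 2) half))))).map (fun ω => ({v : Site 2 | Xor (v 0 ∈ ω.1) (Xor (v 1 ∈ ω.2.1) (Odd ((Finset.filter (fun f : ℤ × ℤ => ![f.1, f.2] ∈ {f : Site 2 | (f 0 ∈ S ∧ f ∈ ω.2.2.1) ∨ (f 0 ∉ S ∧ f ∈ ω.2.2.2.1)}) (Finset.Ico (min 0 (v 0)) (max 0 (v 0)) ×ˢ Finset.Ico (min 0 (v 1)) (max 0 (v 1)))).card)))}, {f : Site 2 | f 0 ∉ S ∨ f ∈ ω.2.2.2.2}))) S).real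
      {x : Obs | ∀ p : List (Site 2), (p ≠ [] ∧ List.IsChain (cellGraph x.2).Adj p ∧ ∀ v ∈ p, v ∉ x.1) →
        (∃ u ∈ p, a ≤ u 0 ∧ u 0 < a + w ∧ b ≤ u 1 ∧ u 1 < b + hh) →
        ∀ v ∈ p, ¬ (v 0 < a - n ∨ a + w + n ≤ v 0 ∨ v 1 < b - n ∨ b + hh + n ≤ v 1)} := hring
  rw [split_nu_eq] at hlr' htb' hring'
  rw [split_ringSet_eq] at hring'
  simp only [Set.univ_inter, probReal_univ, mul_one]
  exact ⟨hlr', htb', hring'⟩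

/-- **THE LINE'S FAR FAMILY ⟹ SUB-CRUX 1** (converse of `farFamily_of_IKFarRSW`: the two statements are equivalent). [folklore] -/
theorem IKFarRSW_of_farFamily :
    (∀ k : ℕ, ∃ c : ℝ, 0 < c ∧ ∀ (S : Set ℤ) (n : ℕ), 1 ≤ n → ∀ (a b : ℤ) (w h : ℕ), n ≤ w → w ≤ k * n → n ≤ h → h ≤ k * n → FarRSWBound c S n a b w h Set.univ) → (let μ := (sitePercolation ℤ half).prod ((sitePercolation ℤ half).prod ((sitePercolation (Site 2) (Set.projIcc (0:ℝ) 1 zero_le_one (2 * Real.sqrt 3 - 3))).prod ((sitePercolation (Site 2) half).prod (sitePercolation (Site 2) half)))); let ν : Set ℤ → Measure (Set (Site 2) × Set (Site 2)) := fun S => μ.map (fun ω => ({v : Site 2 | Xor (v 0 ∈ ω.1) (Xor (v 1 ∈ ω.2.1) (Odd ((Finset.filter (fun f : ℤ × ℤ => ![f.1, f.2] ∈ {f : Site 2 | (f 0 ∈ S ∧ f ∈ ω.2.2.1) ∨ (f 0 ∉ S ∧ f ∈ ω.2.2.2.1)}) (Finset.Ico (min 0 (v 0)) (max 0 (v 0))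 ×ˢ Finset.Ico (min 0 (v 1)) (max 0 (v 1)))).card)))}, {f : Site 2 | f 0 ∉ S ∨ f ∈ ω.2.2.2.2})); let edges : (Set (Site 2) × Set (Site 2)) → BondConfig (Site 2) := fun x => {e | ∃ u v, e = s(u, v) ∧ u ∈ x.1 ∧ v ∈ x.1 ∧ (v = u + ![1, 0] ∨ v = u + ![0, 1] ∨ (v = u + ![1, 1] ∧ ¬ u ∈ x.2) ∨ (v = u + ![1, -1] ∧ (u + ![0, -1]) ∈ x.2))}; let adj : Set (Site 2) → SimpleGraph (Site 2) := fun A => SimpleGraph.fromRel fun u v => v = u + ![1, 0] ∨ v = u + ![0, 1] ∨ (v = u + ![1, 1] ∧ u ∉ A) ∨ (v = u + ![1, -1] ∧ (u + ![0, -1]) ∈ A); ∀ k : ℕ, ∃ c : ℝ, 0 < c ∧ ∀ (S : Set ℤ) (n : ℕ), 1 ≤ n → ∀ (a b : ℤ) (w h : ℕ), n ≤ w → w ≤ k * n → n ≤ h → h ≤ k * n → c ≤ (ν S).real {x | edges x ∈ openCrossing {v : Site 2 | a ≤ v 0 ∧ v 0 < a + w ∧ b ≤ v 1 ∧ v 1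 < b + h} {v : Site 2 | v 0 = a ∧ b ≤ v 1 ∧ v 1 < b + h} {v : Site 2 | v 0 = a + w - 1 ∧ b ≤ v 1 ∧ v 1 < b + h}} ∧ c ≤ (ν S).real {x | edges x ∈ openCrossing {v : Site 2 | a ≤ v 0 ∧ v 0 < a + w ∧ b ≤ v 1 ∧ v 1 < b + h} {v : Site 2 | v 1 = b ∧ a ≤ v 0 ∧ v 0 < a + w} {v : Site 2 | v 1 = b + h - 1 ∧ a ≤ v 0 ∧ v 0 < a + w}} ∧ c ≤ (ν S).real {x | ∀ p : List (Site 2), (p ≠ [] ∧ List.IsChain (adj x.2).Adj p ∧ ∀ v ∈ p, v ∉ x.1) → (∃ u ∈ p, a ≤ u 0 ∧ u 0 < a + w ∧ b ≤ u 1 ∧ u 1 < b + h) → ∀ v ∈ p, ¬ (v 0 < a - n ∨ a + w + n ≤ v 0 ∨ v 1 < b - n ∨ b + h + n ≤ v 1)}) := by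
  intro h
  dsimp only
  intro k
  obtain ⟨c, hc, hk⟩ := h k
  refine ⟨c, hc, fun S n hn a b w hh h1 h2 h3 h4 => ?_⟩
  haveI : IsProbabilityMeasure (νmix S) := isProbabilityMeasure_nuMix S
  have huniv : (Set.univ : Set Obs) ∈ determinedOn (farFrom a b w hh n) :=
    fun _ _ _ => ⟨fun _ => Set.mem_univ _, fun _ => Set.mem_univ _⟩
  obtain ⟨hlr, htb, hring⟩ := hk S n hn a b w hh h1 h2 h3 h4 huniv
  simp only [Set.univ_inter, probReal_univ, mul_one] at hlr htb hring
  rw [← split_ringSet_eq] at hring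
  rw [← split_nu_eq] at hlr htb hring
  exact ⟨hlr, htb, hring⟩

/-- **FAR FAMILY + SUB-CRUX 2 ⟹ THE CRUX** (registered sub-goal `IKLinearTransport_of_farFamily_window`): Manolescu's
window transport given the far family (the inline `IKWindowTransport`, fed with sub-crux 1 recovered from the far family)
implies `IKLinearTransport` BY NAME through the landed line (as `IKLinearTransport_of_farInputs`). [folklore] -/
theorem IKLinearTransport_of_farFamily_window :
    (∀ k : ℕ, ∃ c : ℝ, 0 < c ∧ ∀ (S : Set ℤ) (n : ℕ), 1 ≤ n → ∀ (a b : ℤ) (w h : ℕ), n ≤ w → w ≤ k * n → n ≤ h → h ≤ k * n → FarRSWBound c S n a b w h Set.univ) → (let μ := (sitePercolation ℤ half).prod ((sitePercolation ℤ half).prod ((sitePercolation (Site 2) (Set.projIcc (0:ℝ) 1 zero_le_one (2 * Real.sqrt 3 - 3))).prod ((sitePercolation (Site 2) half).prod (sitePercolation (Site 2) half)))); let ν : Set ℤ → Measure (Set (Site 2) × Set (Site 2)) := fun S => μ.map (fun ω => ({v : Site 2 | Xor (v 0 ∈ ω.1) (Xor (v 1 ∈ ω.2.1) (Odd ((Finset.filter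 (fun f : ℤ × ℤ => ![f.1, f.2] ∈ {f : Site 2 | (f 0 ∈ S ∧ f ∈ ω.2.2.1) ∨ (f 0 ∉ S ∧ f ∈ ω.2.2.2.1)}) (Finset.Ico (min 0 (v 0)) (max 0 (v 0)) ×ˢ Finset.Ico (min 0 (v 1)) (max 0 (v 1)))).card)))}, {f : Site 2 | f 0 ∉ S ∨ f ∈ ω.2.2.2.2})); let edges : (Set (Site 2) × Set (Site 2)) → BondConfig (Site 2) := fun x => {e | ∃ u v, e = s(u, v) ∧ u ∈ x.1 ∧ v ∈ x.1 ∧ (v = u + ![1, 0] ∨ v = u + ![0, 1] ∨ (v = u + ![1, 1] ∧ ¬ u ∈ x.2) ∨ (v = u + ![1, -1] ∧ (u + ![0, -1]) ∈ x.2))}; let adj : Set (Site 2) → SimpleGraph (Site 2) := fun A => SimpleGraph.fromRel fun u v => v = u + ![1, 0] ∨ v = u + ![0, 1] ∨ (v = u + ![1, 1] ∧ u ∉ A) ∨ (v = u + ![1, -1] ∧ (u + ![0, -1]) ∈ A); let paths : (Set (Site 2) × Set (Site 2)) → Bool → Set (List (Site 2)) := fun x bb => {p | p ≠ [] ∧ List.IsChain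 (adj x.2).Adj p ∧ ∀ v ∈ p, (v ∈ x.1 ↔ bb = true)}; let pos : ℝ → (Site 2) → ℂ := fun δ v => (δ : ℂ) * (((v 0 : ℝ) : ℂ) + ((v 1 : ℝ) : ℂ) * Complex.I); let shadows : (ℂ ≃L[ℝ] ℂ) → ℝ → ℝ → List (Site 2) → Set (List (Site 2)) := fun K δ ε p => {p' | (∀ v ∈ p, ∃ w ∈ p', ‖pos δ w - K (pos δ v)‖ ≤ ε) ∧ (∀ w ∈ p', ∃ v ∈ p, ‖pos δ w - K (pos δ v)‖ ≤ ε) ∧ (∀ v w, p.head? = some v → p'.head? = some w → ‖pos δ w - K (pos δ v)‖ ≤ ε) ∧ (∀ v w, p.getLast? = some v → p'.getLast? = some w → ‖pos δ w - K (pos δ v)‖ ≤ ε)}; let bad : (ℂ ≃L[ℝ] ℂ) → ℝ → ℝ → ℝ → Set ((Set (Site 2) × Set (Site 2)) × (Set (Site 2) × Set (Site 2))) := fun K δ ε ρ => {xx' | ∃ bb : Bool, (∃ p ∈ paths xx'.1 bb, (∀ v ∈ p, ‖pos δ v‖ ≤ ρ) ∧ (∃ v ∈ p, ∃ w ∈ p,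 ε ≤ ‖pos δ v - pos δ w‖) ∧ ∀ p' ∈ paths xx'.2 bb, p' ∉ shadows K δ ε p) ∨ (∃ p' ∈ paths xx'.2 bb, (∀ v ∈ p', ‖pos δ v‖ ≤ ρ) ∧ (∃ v ∈ p', ∃ w ∈ p', ε ≤ ‖pos δ v - pos δ w‖) ∧ ∀ p ∈ paths xx'.1 bb, p ∉ shadows K.symm δ ε p')}; (∀ k : ℕ, ∃ c : ℝ, 0 < c ∧ ∀ (S : Set ℤ) (n : ℕ), 1 ≤ n → ∀ (a b : ℤ) (w h : ℕ), n ≤ w → w ≤ k * n → n ≤ h → h ≤ k * n → c ≤ (ν S).real {x | edges x ∈ openCrossing {v : Site 2 | a ≤ v 0 ∧ v 0 < a + w ∧ b ≤ v 1 ∧ v 1 < b + h} {v : Site 2 | v 0 = a ∧ b ≤ v 1 ∧ v 1 < b + h} {v : Site 2 | v 0 = a + w - 1 ∧ b ≤ v 1 ∧ v 1 < b + h}} ∧ c ≤ (ν S).real {x | edges x ∈ openCrossing {v : Site 2 | a ≤ v 0 ∧ v 0 < a + w ∧ b ≤ v 1 ∧ v 1 < b + h} {v : Site 2 | v 1 =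 b ∧ a ≤ v 0 ∧ v 0 < a + w} {v : Site 2 | v 1 = b + h - 1 ∧ a ≤ v 0 ∧ v 0 < a + w}} ∧ c ≤ (ν S).real {x | ∀ p : List (Site 2), (p ≠ [] ∧ List.IsChain (adj x.2).Adj p ∧ ∀ v ∈ p, v ∉ x.1) → (∃ u ∈ p, a ≤ u 0 ∧ u 0 < a + w ∧ b ≤ u 1 ∧ u 1 < b + h) → ∀ v ∈ p, ¬ (v 0 < a - n ∨ a + w + n ≤ v 0 ∨ v 1 < b - n ∨ b + h + n ≤ v 1)}) → ∃ K₁ : ℂ ≃L[ℝ] ℂ, ∀ ε ρ A : ℝ, 0 < ε → 0 < ρ → 0 < A → ∀ᶠ δ in nhdsWithin (0 : ℝ) (Set.Ioi 0), ∃ (S₀ S₁ : Set ℤ) (π : Measure ((Set (Site 2) × Set (Site 2)) × (Set (Site 2) × Set (Site 2)))), (∀ j : ℤ, |j| ≤ (⌈A / δ⌉₊ : ℤ) → j ∈ S₀ ∧ j ∉ S₁) ∧ π.map Prod.fst = ν S₀ ∧ π.map Prod.snd = ν S₁ ∧ π (bad K₁ δ ε ρ) ≤ ENNReal.ofReal ε)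 →
      Summit.CriticalPhenomena.CardyFormulaZ2.Theses.CardyIKTransport.IKLinearTransport := by
  intro hin h₂
  -- sub-crux 2 fed with sub-crux 1 is the line's window transport conclusion
  have hW : ∃ K₁ : ℂ ≃L[ℝ] ℂ, ∀ ε ρ A : ℝ, 0 < ε → 0 < ρ → 0 < A →
      ∀ᶠ δ in 𝓝[>] (0 : ℝ), ∃ (S₀ S₁ : Set ℤ) (π : Measure (Obs × Obs)),
        (∀ j : ℤ, |j| ≤ (⌈A / δ⌉₊ : ℤ) → j ∈ S₀ ∧ j ∉ S₁) ∧
        π.map Prod.fst = νmix S₀ ∧ π.map Prod.snd = νmix S₁ ∧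
        π (badObs K₁ δ ε ρ) ≤ ENNReal.ofReal ε := by
    obtain ⟨K₁, hK⟩ := h₂ (IKFarRSW_of_farFamily hin)
    refine ⟨K₁, fun ε ρ A hε hρ hA => ?_⟩
    filter_upwards [hK ε ρ A hε hρ hA] with δ hδ
    obtain ⟨S₀, S₁, π, hwin, hfst, hsnd, hbad⟩ := hδ
    have hfst' : π.map Prod.fst = (fun S : Set ℤ => ((sitePercolation ℤ half).prod ((sitePercolation ℤ half).prod ((sitePercolation (Site 2) (Set.projIcc (0:ℝ) 1 zero_le_one (2 * Real.sqrt 3 - 3))).prod ((sitePercolation (Site 2) half).prod (sitePercolation (Site 2) half))))).map (fun ω => ({v : Site 2 | Xor (v 0 ∈ ω.1) (Xor (v 1 ∈ ω.2.1) (Odd ((Finset.filter (fun f : ℤ × ℤ => ![f.1, f.2] ∈ {f : Site 2 | (f 0 ∈ S ∧ f ∈ ω.2.2.1) ∨ (f 0 ∉ S ∧ f ∈ ω.2.2.2.1)}) (Finset.Ico (min 0 (v 0)) (max 0 (v 0)) ×ˢ Finset.Ico (min 0 (v 1)) (max 0 (v 1)))).card)))}, {f : Site 2 | f 0 ∉ S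 ∨ f ∈ ω.2.2.2.2}))) S₀ := hfst
    have hsnd' : π.map Prod.snd = (fun S : Set ℤ => ((sitePercolation ℤ half).prod ((sitePercolation ℤ half).prod ((sitePercolation (Site 2) (Set.projIcc (0:ℝ) 1 zero_le_one (2 * Real.sqrt 3 - 3))).prod ((sitePercolation (Site 2) half).prod (sitePercolation (Site 2) half))))).map (fun ω => ({v : Site 2 | Xor (v 0 ∈ ω.1) (Xor (v 1 ∈ ω.2.1) (Odd ((Finset.filter (fun f : ℤ × ℤ => ![f.1, f.2] ∈ {f : Site 2 | (f 0 ∈ S ∧ f ∈ ω.2.2.1) ∨ (f 0 ∉ S ∧ f ∈ ω.2.2.2.1)}) (Finset.Ico (min 0 (v 0)) (max 0 (v 0)) ×ˢ Finset.Ico (min 0 (v 1)) (max 0 (v 1)))).card)))}, {f : Site 2 | f 0 ∉ S ∨ f ∈ ω.2.2.2.2}))) S₁ := hsnd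
    have hbad' : π (badObs K₁ δ ε ρ) ≤ ENNReal.ofReal ε := hbad
    rw [split_nu_eq] at hfst' hsnd'
    exact ⟨S₀, S₁, π, hwin, hfst', hsnd', hbad'⟩
  -- the landed composition (as in `IKLinearTransport_of_farInputs`)
  have hMix : ∀ (k : ℕ) (η : ℝ), 0 < η → ∃ N : ℕ, ∀ (S : Set ℤ) (n : ℕ), N ≤ n → ∀ (a b : ℤ) (w h : ℕ),
      w ≤ k * n → h ≤ k * n → ∀ E L : Set Obs, MeasurableSet E → MeasurableSet L →
      RatioMixBound η S n a b w h E L :=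
    ratioMix_of_masterMul ScreeningAssembly.screeningOffsetMul ScreeningAssembly.screening_master_mul
  have hFar : ∀ k : ℕ, ∃ c : ℝ, 0 < c ∧ ∀ (S : Set ℤ) (n : ℕ), 1 ≤ n → ∀ (a b : ℤ) (w h : ℕ),
      n ≤ w → w ≤ k * n → n ≤ h → h ≤ k * n → ∀ E : Set Obs, MeasurableSet E →
      FarRSWBound c S n a b w h E :=
    stub_FarRSWOfInputs hin hMix
  have hLin : (∃ C c : ℝ, 0 < c ∧ ∀ (S : Set ℤ) (i : ℤ), (i ∈ S ↔ i + 1 ∉ S) →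
        ∃ T : Obs → Rnd → Obs, IsExchangeKernel C c S i T) →
      (∃ c : ℝ, 0 < c ∧ ∀ (S : Set ℤ) (n : ℕ), 1 ≤ n → ∀ (a b : ℤ) (E : Set Obs), MeasurableSet E →
        CondRSWBound c S n a b E) →
      ∃ K₁ : ℂ ≃L[ℝ] ℂ, IsTransportCoupling K₁ :=
    fun hK _ => linearTransport_of_parts_far stripLaw (fun _ _ _ => hW) couplingLift hK hFar hMix
  exact IKLinearTransport_of_stubs stub_DiagramExchange pinnedExchange_holds (condRSW_of_farRSW hFar) hLin
    stub_CouplingToLimits (crudeCardyTri_of stub_TriLawOfEmpty stub_CrudeCardySiteTri)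

/-- **THE SPLIT** `IKLinearTransport ⇐ IKFarRSW ∧ IKWindowTransport` (crux-strategist decomposition of stmt-5076; the glue
item of `ledger route edit --split IKLinearTransport --into IKFarRSW IKWindowTransport` closes by `exact` against this):
sub-crux 1 and sub-crux 2 (both inline) imply the crux BY NAME. [folklore] -/
theorem IKLinearTransport_of_subs :
    (let μ := (sitePercolation ℤ half).prod ((sitePercolation ℤ half).prod ((sitePercolation (Site 2) (Set.projIcc (0:ℝ) 1 zero_le_one (2 * Real.sqrt 3 - 3))).prod ((sitePercolation (Site 2) half).prod (sitePercolation (Site 2) half)))); let ν : Set ℤ → Measure (Set (Site 2) × Set (Site 2)) := fun S => μ.map (fun ω => ({v : Site 2 | Xor (v 0 ∈ ω.1) (Xor (v 1 ∈ ω.2.1) (Odd ((Finset.filter (fun f : ℤ × ℤ => ![f.1, f.2] ∈ {f : Site 2 | (f 0 ∈ S ∧ f ∈ ω.2.2.1) ∨ (f 0 ∉ S ∧ f ∈ ω.2.2.2.1)}) (Finset.Ico (min 0 (v 0)) (max 0 (v 0)) ×ˢ Finset.Ico (min 0 (v 1)) (max 0 (v 1)))).card)))}, {f : Site 2 | f 0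 ∉ S ∨ f ∈ ω.2.2.2.2})); let edges : (Set (Site 2) × Set (Site 2)) → BondConfig (Site 2) := fun x => {e | ∃ u v, e = s(u, v) ∧ u ∈ x.1 ∧ v ∈ x.1 ∧ (v = u + ![1, 0] ∨ v = u + ![0, 1] ∨ (v = u + ![1, 1] ∧ ¬ u ∈ x.2) ∨ (v = u + ![1, -1] ∧ (u + ![0, -1]) ∈ x.2))}; let adj : Set (Site 2) → SimpleGraph (Site 2) := fun A => SimpleGraph.fromRel fun u v => v = u + ![1, 0] ∨ v = u + ![0, 1] ∨ (v = u + ![1, 1] ∧ u ∉ A) ∨ (v = u + ![1, -1] ∧ (u + ![0, -1]) ∈ A); ∀ k : ℕ, ∃ c : ℝ, 0 < c ∧ ∀ (S : Set ℤ) (n : ℕ), 1 ≤ n → ∀ (a b : ℤ) (w h : ℕ), n ≤ w → w ≤ k * n → n ≤ h → h ≤ k * n → c ≤ (ν S).real {x | edges x ∈ openCrossing {v : Site 2 | a ≤ v 0 ∧ v 0 < a + w ∧ b ≤ v 1 ∧ v 1 < b + h} {v : Site 2 | v 0 = a ∧ b ≤ v 1 ∧ v 1 < b + h} {v : Site 2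 | v 0 = a + w - 1 ∧ b ≤ v 1 ∧ v 1 < b + h}} ∧ c ≤ (ν S).real {x | edges x ∈ openCrossing {v : Site 2 | a ≤ v 0 ∧ v 0 < a + w ∧ b ≤ v 1 ∧ v 1 < b + h} {v : Site 2 | v 1 = b ∧ a ≤ v 0 ∧ v 0 < a + w} {v : Site 2 | v 1 = b + h - 1 ∧ a ≤ v 0 ∧ v 0 < a + w}} ∧ c ≤ (ν S).real {x | ∀ p : List (Site 2), (p ≠ [] ∧ List.IsChain (adj x.2).Adj p ∧ ∀ v ∈ p, v ∉ x.1) → (∃ u ∈ p, a ≤ u 0 ∧ u 0 < a + w ∧ b ≤ u 1 ∧ u 1 < b + h) → ∀ v ∈ p, ¬ (v 0 < a - n ∨ a + w + n ≤ v 0 ∨ v 1 < b - n ∨ b + h + n ≤ v 1)}) → (let μ := (sitePercolation ℤ half).prod ((sitePercolation ℤ half).prod ((sitePercolation (Site 2) (Set.projIcc (0:ℝ) 1 zero_le_one (2 * Real.sqrt 3 - 3))).prod ((sitePercolation (Site 2) half).prod (sitePercolation (Site 2) half)))); let ν : Set ℤ → Measure (Set (Site 2) × Set (Site 2)) := fun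 S => μ.map (fun ω => ({v : Site 2 | Xor (v 0 ∈ ω.1) (Xor (v 1 ∈ ω.2.1) (Odd ((Finset.filter (fun f : ℤ × ℤ => ![f.1, f.2] ∈ {f : Site 2 | (f 0 ∈ S ∧ f ∈ ω.2.2.1) ∨ (f 0 ∉ S ∧ f ∈ ω.2.2.2.1)}) (Finset.Ico (min 0 (v 0)) (max 0 (v 0)) ×ˢ Finset.Ico (min 0 (v 1)) (max 0 (v 1)))).card)))}, {f : Site 2 | f 0 ∉ S ∨ f ∈ ω.2.2.2.2})); let edges : (Set (Site 2) × Set (Site 2)) → BondConfig (Site 2) := fun x => {e | ∃ u v, e = s(u, v) ∧ u ∈ x.1 ∧ v ∈ x.1 ∧ (v = u + ![1, 0] ∨ v = u + ![0, 1] ∨ (v = u + ![1, 1] ∧ ¬ u ∈ x.2) ∨ (v = u + ![1, -1] ∧ (u + ![0, -1]) ∈ x.2))}; let adj : Set (Site 2) → SimpleGraph (Site 2) := fun A => SimpleGraph.fromRel fun u v => v = u + ![1, 0] ∨ v = u + ![0, 1] ∨ (v = u + ![1, 1] ∧ u ∉ A) ∨ (v = u + ![1, -1] ∧ (u + ![0,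 -1]) ∈ A); let paths : (Set (Site 2) × Set (Site 2)) → Bool → Set (List (Site 2)) := fun x bb => {p | p ≠ [] ∧ List.IsChain (adj x.2).Adj p ∧ ∀ v ∈ p, (v ∈ x.1 ↔ bb = true)}; let pos : ℝ → (Site 2) → ℂ := fun δ v => (δ : ℂ) * (((v 0 : ℝ) : ℂ) + ((v 1 : ℝ) : ℂ) * Complex.I); let shadows : (ℂ ≃L[ℝ] ℂ) → ℝ → ℝ → List (Site 2) → Set (List (Site 2)) := fun K δ ε p => {p' | (∀ v ∈ p, ∃ w ∈ p', ‖pos δ w - K (pos δ v)‖ ≤ ε) ∧ (∀ w ∈ p', ∃ v ∈ p, ‖pos δ w - K (pos δ v)‖ ≤ ε) ∧ (∀ v w, p.head? = some v → p'.head? = some w → ‖pos δ w - K (pos δ v)‖ ≤ ε) ∧ (∀ v w, p.getLast? = some v → p'.getLast? = some w → ‖pos δ w - K (pos δ v)‖ ≤ ε)}; let bad : (ℂ ≃L[ℝ] ℂ) → ℝ → ℝ → ℝ → Set ((Set (Site 2) × Set (Site 2)) × (Set (Site 2) × Set (Site 2))) := fun K δ ε ρ => {xx' | ∃ bb : Bool,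 (∃ p ∈ paths xx'.1 bb, (∀ v ∈ p, ‖pos δ v‖ ≤ ρ) ∧ (∃ v ∈ p, ∃ w ∈ p, ε ≤ ‖pos δ v - pos δ w‖) ∧ ∀ p' ∈ paths xx'.2 bb, p' ∉ shadows K δ ε p) ∨ (∃ p' ∈ paths xx'.2 bb, (∀ v ∈ p', ‖pos δ v‖ ≤ ρ) ∧ (∃ v ∈ p', ∃ w ∈ p', ε ≤ ‖pos δ v - pos δ w‖) ∧ ∀ p ∈ paths xx'.1 bb, p ∉ shadows K.symm δ ε p')}; (∀ k : ℕ, ∃ c : ℝ, 0 < c ∧ ∀ (S : Set ℤ) (n : ℕ), 1 ≤ n → ∀ (a b : ℤ) (w h : ℕ), n ≤ w → w ≤ k * n → n ≤ h → h ≤ k * n → c ≤ (ν S).real {x | edges x ∈ openCrossing {v : Site 2 | a ≤ v 0 ∧ v 0 < a + w ∧ b ≤ v 1 ∧ v 1 < b + h} {v : Site 2 | v 0 = a ∧ b ≤ v 1 ∧ v 1 < b + h} {v : Site 2 | v 0 = a + w - 1 ∧ b ≤ v 1 ∧ v 1 < b + h}} ∧ c ≤ (ν S).real {x | edges x ∈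 openCrossing {v : Site 2 | a ≤ v 0 ∧ v 0 < a + w ∧ b ≤ v 1 ∧ v 1 < b + h} {v : Site 2 | v 1 = b ∧ a ≤ v 0 ∧ v 0 < a + w} {v : Site 2 | v 1 = b + h - 1 ∧ a ≤ v 0 ∧ v 0 < a + w}} ∧ c ≤ (ν S).real {x | ∀ p : List (Site 2), (p ≠ [] ∧ List.IsChain (adj x.2).Adj p ∧ ∀ v ∈ p, v ∉ x.1) → (∃ u ∈ p, a ≤ u 0 ∧ u 0 < a + w ∧ b ≤ u 1 ∧ u 1 < b + h) → ∀ v ∈ p, ¬ (v 0 < a - n ∨ a + w + n ≤ v 0 ∨ v 1 < b - n ∨ b + h + n ≤ v 1)}) → ∃ K₁ : ℂ ≃L[ℝ] ℂ, ∀ ε ρ A : ℝ, 0 < ε → 0 < ρ → 0 < A → ∀ᶠ δ in nhdsWithin (0 : ℝ) (Set.Ioi 0), ∃ (S₀ S₁ : Set ℤ) (π : Measure ((Set (Site 2) × Set (Site 2)) × (Set (Site 2) × Set (Site 2)))), (∀ j : ℤ, |j| ≤ (⌈A / δ⌉₊ : ℤ) → j ∈ S₀ ∧ j ∉ S₁)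 ∧ π.map Prod.fst = ν S₀ ∧ π.map Prod.snd = ν S₁ ∧ π (bad K₁ δ ε ρ) ≤ ENNReal.ofReal ε) →
      Summit.CriticalPhenomena.CardyFormulaZ2.Theses.CardyIKTransport.IKLinearTransport :=
  fun h₁ h₂ => IKLinearTransport_of_farFamily_window (farFamily_of_IKFarRSW h₁) h₂

end Summit.CriticalPhenomena.CardyFormulaZ2.Theorems.IKLinearTransport.FarWindowSplit

end
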